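import Literature.Barriers.CriticalPhenomena.PlaquetteWalkYBIdentity
import Literature.Barriers.CriticalPhenomena.PlaquetteWalkWeightRigidityPrinted
import Mathlib
import HarnessLib

/-!
# Barrier catalogue (SAWScalingLimit): the TWO-SIDED classification of exact plaquette vertex relations
on `ℤ²` at `σ = 5/8`, with one technique class (row-convex domains)

Companion of `PlaquetteWalkSpinRigidity` / `PlaquetteWalkWeightRigidityPrinted` (necessity, from the
relation on ALL face lists) and `PlaquetteWalkYBIdentity` (sufficiency: the printed Yang–Baxter weights
carry the relation for every OUTER root, in particular on every ROW-CONVEX list for every boundary root).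
The necessity chain of `PlaquetteWalkSpinRigidity.lean` uses fourteen kernel instances on row-convex
domains of ≤ 7 faces only, so it runs from the weaker row-convex class `ExactPlaquetteVertexRelationRC`
(this file re-runs the instances with the weakened hypothesis and reuses the tree's private algebra via
`open private … from`, as in `Literature/Combinatorics/Sahi2008/FKGCumulation.lean`). Result:
`PlaquetteWalkYBClassification_holds` — (→) `W(θ)` satisfies the RC class with coefficients
`(1, r(θ), −1, −r(θ))` for every `θ ∈ [π/3, 2π/3]`; (←) an RC-class relation with `u₁u₂v ≠ 0`, `c ≠ 0`,
`c_E + c_W = 0`, ratio `r(θ)` forces `W = W(θ)`. Also `t_pow_sixteen_of_exactPlaquetteVertexRelationRC`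
(spin rigidity from the RC class) and `weights_eq_ybCurveRC`. Sources: [cite: GlazmanManolescu2019, eq. (1),
Lemma 2.1]; [cite: Glazman2015WeightedSAW, Lemma 3.1].

Status in print (venture lane «pcv-sawmu», label cell of record lit-1 g13 / lit-2 g15): CONSOLIDATION AT
KERNEL RIGOUR of Ikhlef–Cardy's printed REAL classification of the square-lattice O(n) weights by
discrete holomorphicity («discretely holomorphic precisely on the integrable manifolds»; determinant
`(n²−1) sin φ sin(φ−πs)(2cos 4πs − 3n + n³)`; `n = 0` gives `s = 5/8`, the lane's `σ`)
[cite: IkhlefCardy2009, §3 (arXiv:0810.5037: linear system (15a)–(15d) p. 8; determinant, cos 4πs = cos 6η (18) and the Yang–Baxter weights (20) p. 10 — real weights)],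
and of Glazman's uniqueness lemma
[cite: Glazman2015WeightedSAW, Lemma 3.1 (ECP 20 (2015) no. 86, pp. 5–6: uniqueness of the weights solving (3.2) at σ = ℓ/8, θ ∈ [π/3, 2π/3] real)],
restricted to the lane's coefficient class `ExactPlaquetteVertexRelationRC` with the gauge `ε`; the
(→) direction from the GLOBAL row-convex class (fourteen kernel instances of ≤ 7 faces) is the new
kernel content.

Written for the venture lane «pcv-sawmu» (Tier B; b-engine-1 gen 9; HOME object, successor files after
`YangBaxterSAWGeneralDomain` (F1) and `PlaquetteWalkYBIdentity` (F2)).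
-/

noncomputable section

/-! ## Necessity from the ROW-CONVEX class and the two-sided classification (C-B1 ∧ C-B2)

The tree's necessity theorems (`PlaquetteWalkSpinRigidity`, `weight_rigidity`, `weights_eq_ybCurve`,
`weights_eq_printedWeights`) assume the vertex relation for EVERY boundary root of EVERY face list —
a hypothesis the printed weights do NOT satisfy (hole-boundary roots). The fourteen kernel instances
behind them, however, live on row-convex domains of at most seven faces, rooted on the boundary. So
the whole necessity chain runs from the weaker ROW-CONVEX class `ExactPlaquetteVertexRelationRC`,
which the printed weights DO satisfy (`vertexFunctional_printed_eq_zero_of_rowConvex`). This section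
re-runs that chain (the instances and the private algebra of `PlaquetteWalkSpinRigidity.lean`,
verbatim with the hypothesis weakened) and states the classification with ONE class on both sides:
`PlaquetteWalkYBClassification_holds`. -/

namespace Literature.Barriers.CriticalPhenomena.PlaquetteWalk

open Literature.Probability.RandomPlanarGeometry.SAW.YangBaxter Real Complex

/-- **Technique class, row-convex domains** `ExactPlaquetteVertexRelationRC W t c`: the exact vertex
relation with coefficients `c` at every face of every ROW-CONVEX finite face list for every boundary
root (weaker than `ExactPlaquetteVertexRelation`; satisfied by the printed Yang–Baxter weights).
[cite: GlazmanManolescu2019, Lemma 2.1 (shape: a relation at each rhombus of Rect_{T,L})] -/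
def ExactPlaquetteVertexRelationRC (W : CWeights) (t : ℂ) (c : Fin 4 → ℂ) : Prop :=
  ∀ (Dl : List Face) (a : MidEdge) (f₀ : Face), RowConvex Dl → f₀ ∈ Dl → IsBoundaryRoot Dl a →
    vertexFunctional W t c Dl a f₀ = 0

/-- The all-domains class implies the row-convex class. [cite: GlazmanManolescu2019, Lemma 2.1] -/
theorem ExactPlaquetteVertexRelation.toRC {W : CWeights} {t : ℂ} {c : Fin 4 → ℂ}
    (h : ExactPlaquetteVertexRelation W t c) : ExactPlaquetteVertexRelationRC W t c :=
  fun Dl a f₀ _ hf ha => h Dl a f₀ hf ha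

/-- **Sufficiency**: the printed Yang–Baxter weights with the Yang–Baxter coefficients satisfy the
row-convex class, for every `θ ∈ [π/3, 2π/3]`. [cite: GlazmanManolescu2019, Lemma 2.1] -/
theorem exactPlaquetteVertexRelationRC_printed {θ : ℝ} (hθ : θ ∈ Set.Icc (π / 3) (2 * π / 3)) :
    ExactPlaquetteVertexRelationRC (printedWeights θ) tFiveEighths (ybCoeff θ) :=
  fun _ _ f₀ hD hf ha => vertexFunctional_printed_eq_zero_of_rowConvex hθ hD ha f₀ hf

/-- The Yang–Baxter coefficients are `ρ²`-odd with ratio `r(θ)`: `c_E + c_W = 0` and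
`c_N − c_S = r(θ)(c_E − c_W)`. [cite: GlazmanManolescu2019, Lemma 2.1, eq. (2.2)] -/
theorem ybCoeff_odd (θ : ℝ) : ybCoeff θ 0 + ybCoeff θ 2 = 0 ∧ ybCoeff θ 1 - ybCoeff θ 3 = ybRatio θ * (ybCoeff θ 0 - ybCoeff θ 2) := by
  have c0 : ybCoeff θ 0 = 1 := rfl
  have c1 : ybCoeff θ 1 = ybRatio θ := rfl
  have c2 : ybCoeff θ 2 = -1 := rfl
  have c3 : ybCoeff θ 3 = -ybRatio θ := rfl
  rw [c0, c1, c2, c3]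
  constructor <;> ring

open private vertexFunctional_mul_pow_eq_rowSumN t_pow_sixteen_of_forms rigidity_of_forms exists_eps_component_ne_zero
  t_pow_four_ne_one eq_ybCurve_of_system from Literature.Barriers.CriticalPhenomena.PlaquetteWalkSpinRigidity

section RigidityRC

variable {W : CWeights} {t : ℂ} {c : Fin 4 → ℂ}

/-- Instance `IE`: faces `[(0, 0)]`, root = the `E` side of `(0,0)`, relation at `(0,0)`;
4 walks end on a side of `(0,0)` (row cleared by `t^1`). [folklore] -/
private theorem inst_IE (hrel : ExactPlaquetteVertexRelationRC W t c) (ht : t ≠ 0) :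
    c 0 * t + c 2 * W.v * t + c 3 * W.u₁ * t ^ 2 + c 1 * W.u₂ = 0 := by
  have hT : termsN [(0, 0)] (Face.side (0, 0) .E) (0, 0) (depth [(0, 0)]) 1 =
      [⟨0, 0, 0, 0, 0, 0, 1⟩, ⟨2, 0, 0, 1, 0, 0, 1⟩, ⟨3, 1, 0, 0, 0, 0, 2⟩, ⟨1, 0, 1, 0, 0, 0, 0⟩] := by
    decide
  have hrow := vertexFunctional_mul_pow_eq_rowSumN W ht c [(0, 0)] (Face.side (0, 0) .E) (0, 0) 1
    (by decide)
  rw [hrel _ _ _ (by decide) (by decide) (by decide), zero_mul, hT] at hrow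
  simp only [rowSumN, List.map_cons, List.map_nil, List.sum_cons, List.sum_nil, CWeights.mono, pow_zero,
    pow_one, mul_one, one_mul] at hrow
  linear_combination -hrow

/-- Instance `IN`: faces `[(0, 0)]`, root = the `N` side of `(0,0)`, relation at `(0,0)`;
4 walks end on a side of `(0,0)` (row cleared by `t^1`). [folklore] -/
private theorem inst_IN (hrel : ExactPlaquetteVertexRelationRC W t c) (ht : t ≠ 0) :
    c 1 * t + c 2 * W.u₁ + c 0 * W.u₂ * t ^ 2 + c 3 * W.v * t = 0 := by
  have hT : termsN [(0, 0)] (Face.side (0, 0) .N) (0, 0) (depth [(0, 0)]) 1 =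
      [⟨1, 0, 0, 0, 0, 0, 1⟩, ⟨2, 1, 0, 0, 0, 0, 0⟩, ⟨0, 0, 1, 0, 0, 0, 2⟩, ⟨3, 0, 0, 1, 0, 0, 1⟩] := by
    decide
  have hrow := vertexFunctional_mul_pow_eq_rowSumN W ht c [(0, 0)] (Face.side (0, 0) .N) (0, 0) 1
    (by decide)
  rw [hrel _ _ _ (by decide) (by decide) (by decide), zero_mul, hT] at hrow
  simp only [rowSumN, List.map_cons, List.map_nil, List.sum_cons, List.sum_nil, CWeights.mono, pow_zero,
    pow_one, mul_one, one_mul] at hrow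
  linear_combination -hrow

/-- Instance `IW`: faces `[(0, 0)]`, root = the `W` side of `(0,0)`, relation at `(0,0)`;
4 walks end on a side of `(0,0)` (row cleared by `t^1`). [folklore] -/
private theorem inst_IW (hrel : ExactPlaquetteVertexRelationRC W t c) (ht : t ≠ 0) :
    c 2 * t + c 0 * W.v * t + c 3 * W.u₂ + c 1 * W.u₁ * t ^ 2 = 0 := by
  have hT : termsN [(0, 0)] (Face.side (0, 0) .W) (0, 0) (depth [(0, 0)]) 1 =
      [⟨2, 0, 0, 0, 0, 0, 1⟩, ⟨0, 0, 0, 1, 0, 0, 1⟩, ⟨3, 0, 1, 0, 0, 0, 0⟩, ⟨1, 1, 0, 0, 0, 0, 2⟩] := by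
    decide
  have hrow := vertexFunctional_mul_pow_eq_rowSumN W ht c [(0, 0)] (Face.side (0, 0) .W) (0, 0) 1
    (by decide)
  rw [hrel _ _ _ (by decide) (by decide) (by decide), zero_mul, hT] at hrow
  simp only [rowSumN, List.map_cons, List.map_nil, List.sum_cons, List.sum_nil, CWeights.mono, pow_zero,
    pow_one, mul_one, one_mul] at hrow
  linear_combination -hrow

/-- Instance `IS`: faces `[(0, 0)]`, root = the `S` side of `(0,0)`, relation at `(0,0)`;
4 walks end on a side of `(0,0)` (row cleared by `t^1`). [folklore] -/
private theorem inst_IS (hrel : ExactPlaquetteVertexRelationRC W t c) (ht : t ≠ 0) :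
    c 3 * t + c 2 * W.u₂ * t ^ 2 + c 0 * W.u₁ + c 1 * W.v * t = 0 := by
  have hT : termsN [(0, 0)] (Face.side (0, 0) .S) (0, 0) (depth [(0, 0)]) 1 =
      [⟨3, 0, 0, 0, 0, 0, 1⟩, ⟨2, 0, 1, 0, 0, 0, 2⟩, ⟨0, 1, 0, 0, 0, 0, 0⟩, ⟨1, 0, 0, 1, 0, 0, 1⟩] := by
    decide
  have hrow := vertexFunctional_mul_pow_eq_rowSumN W ht c [(0, 0)] (Face.side (0, 0) .S) (0, 0) 1
    (by decide)
  rw [hrel _ _ _ (by decide) (by decide) (by decide), zero_mul, hT] at hrow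
  simp only [rowSumN, List.map_cons, List.map_nil, List.sum_cons, List.sum_nil, CWeights.mono, pow_zero,
    pow_one, mul_one, one_mul] at hrow
  linear_combination -hrow

/-- Instance `BNWE`: faces `[(0, 0), (0, 1), (-1, 1), (-1, 0)]`, root = the `E` side of `(0,0)`, relation at `(0,0)`;
7 walks end on a side of `(0,0)` (row cleared by `t^3`). [folklore] -/
private theorem inst_BNWE (hrel : ExactPlaquetteVertexRelationRC W t c) (ht : t ≠ 0) :
    c 0 * t ^ 3 + c 3 * W.u₁ * t ^ 4 + c 1 * W.u₂ * t ^ 2 + c 2 * W.u₁ * W.u₂ ^ 3 * t ^ 5 + c 3 * W.u₁ * W.u₂ ^ 2 * W.w₂ * t ^ 4 + c 2 * W.v * t ^ 3 + c 1 * W.u₁ * W.u₂ ^ 2 * W.v = 0 := by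
  have hT : termsN [(0, 0), (0, 1), (-1, 1), (-1, 0)] (Face.side (0, 0) .E) (0, 0) (depth [(0, 0), (0, 1), (-1, 1), (-1, 0)]) 3 =
      [⟨0, 0, 0, 0, 0, 0, 3⟩, ⟨3, 1, 0, 0, 0, 0, 4⟩, ⟨1, 0, 1, 0, 0, 0, 2⟩, ⟨2, 1, 3, 0, 0, 0, 5⟩, ⟨3, 1, 2, 0, 0, 1, 4⟩, ⟨2, 0, 0, 1, 0, 0, 3⟩, ⟨1, 1, 2, 1, 0, 0, 0⟩] := by
    decide
  have hrow := vertexFunctional_mul_pow_eq_rowSumN W ht c [(0, 0), (0, 1), (-1, 1), (-1, 0)] (Face.side (0, 0) .E) (0, 0) 3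
    (by decide)
  rw [hrel _ _ _ (by decide) (by decide) (by decide), zero_mul, hT] at hrow
  simp only [rowSumN, List.map_cons, List.map_nil, List.sum_cons, List.sum_nil, CWeights.mono, pow_zero,
    pow_one, mul_one, one_mul] at hrow
  linear_combination -hrow

/-- Instance `BNWS`: faces `[(0, 0), (0, 1), (-1, 1), (-1, 0)]`, root = the `S` side of `(0,0)`, relation at `(0,0)`;
7 walks end on a side of `(0,0)` (row cleared by `t^2`). [folklore] -/
private theorem inst_BNWS (hrel : ExactPlaquetteVertexRelationRC W t c) (ht : t ≠ 0) :
    c 3 * t ^ 2 + c 0 * W.u₁ * t + c 1 * W.v * t ^ 2 + c 2 * W.u₁ * W.u₂ ^ 2 * W.v * t ^ 5 + c 2 * W.u₂ * t ^ 3 + c 1 * W.u₁ * W.u₂ ^ 3 + c 0 * W.u₁ * W.u₂ ^ 2 * W.w₂ * t = 0 := by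
  have hT : termsN [(0, 0), (0, 1), (-1, 1), (-1, 0)] (Face.side (0, 0) .S) (0, 0) (depth [(0, 0), (0, 1), (-1, 1), (-1, 0)]) 2 =
      [⟨3, 0, 0, 0, 0, 0, 2⟩, ⟨0, 1, 0, 0, 0, 0, 1⟩, ⟨1, 0, 0, 1, 0, 0, 2⟩, ⟨2, 1, 2, 1, 0, 0, 5⟩, ⟨2, 0, 1, 0, 0, 0, 3⟩, ⟨1, 1, 3, 0, 0, 0, 0⟩, ⟨0, 1, 2, 0, 0, 1, 1⟩] := by
    decide
  have hrow := vertexFunctional_mul_pow_eq_rowSumN W ht c [(0, 0), (0, 1), (-1, 1), (-1, 0)] (Face.side (0, 0) .S) (0, 0) 2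
    (by decide)
  rw [hrel _ _ _ (by decide) (by decide) (by decide), zero_mul, hT] at hrow
  simp only [rowSumN, List.map_cons, List.map_nil, List.sum_cons, List.sum_nil, CWeights.mono, pow_zero,
    pow_one, mul_one, one_mul] at hrow
  linear_combination -hrow

/-- Instance `BNEW`: faces `[(0, 0), (0, 1), (1, 1), (1, 0)]`, root = the `W` side of `(0,0)`, relation at `(0,0)`;
7 walks end on a side of `(0,0)` (row cleared by `t^2`). [folklore] -/
private theorem inst_BNEW (hrel : ExactPlaquetteVertexRelationRC W t c) (ht : t ≠ 0) :
    c 2 * t ^ 2 + c 3 * W.u₂ * t + c 1 * W.u₁ * t ^ 3 + c 0 * W.u₁ ^ 3 * W.u₂ + c 3 * W.u₁ ^ 2 * W.u₂ * W.w₁ * t + c 0 * W.v * t ^ 2 + c 1 * W.u₁ ^ 2 * W.u₂ * W.v * t ^ 5 = 0 := by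
  have hT : termsN [(0, 0), (0, 1), (1, 1), (1, 0)] (Face.side (0, 0) .W) (0, 0) (depth [(0, 0), (0, 1), (1, 1), (1, 0)]) 2 =
      [⟨2, 0, 0, 0, 0, 0, 2⟩, ⟨3, 0, 1, 0, 0, 0, 1⟩, ⟨1, 1, 0, 0, 0, 0, 3⟩, ⟨0, 3, 1, 0, 0, 0, 0⟩, ⟨3, 2, 1, 0, 1, 0, 1⟩, ⟨0, 0, 0, 1, 0, 0, 2⟩, ⟨1, 2, 1, 1, 0, 0, 5⟩] := by
    decide
  have hrow := vertexFunctional_mul_pow_eq_rowSumN W ht c [(0, 0), (0, 1), (1, 1), (1, 0)] (Face.side (0, 0) .W) (0, 0) 2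
    (by decide)
  rw [hrel _ _ _ (by decide) (by decide) (by decide), zero_mul, hT] at hrow
  simp only [rowSumN, List.map_cons, List.map_nil, List.sum_cons, List.sum_nil, CWeights.mono, pow_zero,
    pow_one, mul_one, one_mul] at hrow
  linear_combination -hrow

/-- Instance `BNES`: faces `[(0, 0), (0, 1), (1, 1), (1, 0)]`, root = the `S` side of `(0,0)`, relation at `(0,0)`;
7 walks end on a side of `(0,0)` (row cleared by `t^3`). [folklore] -/
private theorem inst_BNES (hrel : ExactPlaquetteVertexRelationRC W t c) (ht : t ≠ 0) :
    c 3 * t ^ 3 + c 2 * W.u₂ * t ^ 4 + c 1 * W.v * t ^ 3 + c 0 * W.u₁ ^ 2 * W.u₂ * W.v + c 0 * W.u₁ * t ^ 2 + c 1 * W.u₁ ^ 3 * W.u₂ * t ^ 5 + c 2 * W.u₁ ^ 2 * W.u₂ * W.w₁ * t ^ 4 = 0 := by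
  have hT : termsN [(0, 0), (0, 1), (1, 1), (1, 0)] (Face.side (0, 0) .S) (0, 0) (depth [(0, 0), (0, 1), (1, 1), (1, 0)]) 3 =
      [⟨3, 0, 0, 0, 0, 0, 3⟩, ⟨2, 0, 1, 0, 0, 0, 4⟩, ⟨1, 0, 0, 1, 0, 0, 3⟩, ⟨0, 2, 1, 1, 0, 0, 0⟩, ⟨0, 1, 0, 0, 0, 0, 2⟩, ⟨1, 3, 1, 0, 0, 0, 5⟩, ⟨2, 2, 1, 0, 1, 0, 4⟩] := by
    decide
  have hrow := vertexFunctional_mul_pow_eq_rowSumN W ht c [(0, 0), (0, 1), (1, 1), (1, 0)] (Face.side (0, 0) .S) (0, 0) 3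
    (by decide)
  rw [hrel _ _ _ (by decide) (by decide) (by decide), zero_mul, hT] at hrow
  simp only [rowSumN, List.map_cons, List.map_nil, List.sum_cons, List.sum_nil, CWeights.mono, pow_zero,
    pow_one, mul_one, one_mul] at hrow
  linear_combination -hrow

/-- Instance `BSWE`: faces `[(0, 0), (0, -1), (-1, -1), (-1, 0)]`, root = the `E` side of `(0,0)`, relation at `(0,0)`;
7 walks end on a side of `(0,0)` (row cleared by `t^2`). [folklore] -/
private theorem inst_BSWE (hrel : ExactPlaquetteVertexRelationRC W t c) (ht : t ≠ 0) :
    c 0 * t ^ 2 + c 1 * W.u₂ * t + c 3 * W.u₁ * t ^ 3 + c 2 * W.u₁ ^ 3 * W.u₂ + c 1 * W.u₁ ^ 2 * W.u₂ * W.w₁ * t + c 2 * W.v * t ^ 2 + c 3 * W.u₁ ^ 2 * W.u₂ * W.v * t ^ 5 = 0 := by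
  have hT : termsN [(0, 0), (0, -1), (-1, -1), (-1, 0)] (Face.side (0, 0) .E) (0, 0) (depth [(0, 0), (0, -1), (-1, -1), (-1, 0)]) 2 =
      [⟨0, 0, 0, 0, 0, 0, 2⟩, ⟨1, 0, 1, 0, 0, 0, 1⟩, ⟨3, 1, 0, 0, 0, 0, 3⟩, ⟨2, 3, 1, 0, 0, 0, 0⟩, ⟨1, 2, 1, 0, 1, 0, 1⟩, ⟨2, 0, 0, 1, 0, 0, 2⟩, ⟨3, 2, 1, 1, 0, 0, 5⟩] := by
    decide
  have hrow := vertexFunctional_mul_pow_eq_rowSumN W ht c [(0, 0), (0, -1), (-1, -1), (-1, 0)] (Face.side (0, 0) .E) (0, 0) 2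
    (by decide)
  rw [hrel _ _ _ (by decide) (by decide) (by decide), zero_mul, hT] at hrow
  simp only [rowSumN, List.map_cons, List.map_nil, List.sum_cons, List.sum_nil, CWeights.mono, pow_zero,
    pow_one, mul_one, one_mul] at hrow
  linear_combination -hrow

/-- Instance `BSWN`: faces `[(0, 0), (0, -1), (-1, -1), (-1, 0)]`, root = the `N` side of `(0,0)`, relation at `(0,0)`;
7 walks end on a side of `(0,0)` (row cleared by `t^3`). [folklore] -/
private theorem inst_BSWN (hrel : ExactPlaquetteVertexRelationRC W t c) (ht : t ≠ 0) :
    c 1 * t ^ 3 + c 0 * W.u₂ * t ^ 4 + c 3 * W.v * t ^ 3 + c 2 * W.u₁ ^ 2 * W.u₂ * W.v + c 2 * W.u₁ * t ^ 2 + c 3 * W.u₁ ^ 3 * W.u₂ * t ^ 5 + c 0 * W.u₁ ^ 2 * W.u₂ * W.w₁ * t ^ 4 = 0 := by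
  have hT : termsN [(0, 0), (0, -1), (-1, -1), (-1, 0)] (Face.side (0, 0) .N) (0, 0) (depth [(0, 0), (0, -1), (-1, -1), (-1, 0)]) 3 =
      [⟨1, 0, 0, 0, 0, 0, 3⟩, ⟨0, 0, 1, 0, 0, 0, 4⟩, ⟨3, 0, 0, 1, 0, 0, 3⟩, ⟨2, 2, 1, 1, 0, 0, 0⟩, ⟨2, 1, 0, 0, 0, 0, 2⟩, ⟨3, 3, 1, 0, 0, 0, 5⟩, ⟨0, 2, 1, 0, 1, 0, 4⟩] := by
    decide
  have hrow := vertexFunctional_mul_pow_eq_rowSumN W ht c [(0, 0), (0, -1), (-1, -1), (-1, 0)] (Face.side (0, 0) .N) (0, 0) 3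
    (by decide)
  rw [hrel _ _ _ (by decide) (by decide) (by decide), zero_mul, hT] at hrow
  simp only [rowSumN, List.map_cons, List.map_nil, List.sum_cons, List.sum_nil, CWeights.mono, pow_zero,
    pow_one, mul_one, one_mul] at hrow
  linear_combination -hrow

/-- Instance `BSEW`: faces `[(0, 0), (0, -1), (1, -1), (1, 0)]`, root = the `W` side of `(0,0)`, relation at `(0,0)`;
7 walks end on a side of `(0,0)` (row cleared by `t^3`). [folklore] -/
private theorem inst_BSEW (hrel : ExactPlaquetteVertexRelationRC W t c) (ht : t ≠ 0) :
    c 2 * t ^ 3 + c 1 * W.u₁ * t ^ 4 + c 3 * W.u₂ * t ^ 2 + c 0 * W.u₁ * W.u₂ ^ 3 * t ^ 5 + c 1 * W.u₁ * W.u₂ ^ 2 * W.w₂ * t ^ 4 + c 0 * W.v * t ^ 3 + c 3 * W.u₁ * W.u₂ ^ 2 * W.v = 0 := by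
  have hT : termsN [(0, 0), (0, -1), (1, -1), (1, 0)] (Face.side (0, 0) .W) (0, 0) (depth [(0, 0), (0, -1), (1, -1), (1, 0)]) 3 =
      [⟨2, 0, 0, 0, 0, 0, 3⟩, ⟨1, 1, 0, 0, 0, 0, 4⟩, ⟨3, 0, 1, 0, 0, 0, 2⟩, ⟨0, 1, 3, 0, 0, 0, 5⟩, ⟨1, 1, 2, 0, 0, 1, 4⟩, ⟨0, 0, 0, 1, 0, 0, 3⟩, ⟨3, 1, 2, 1, 0, 0, 0⟩] := by
    decide
  have hrow := vertexFunctional_mul_pow_eq_rowSumN W ht c [(0, 0), (0, -1), (1, -1), (1, 0)] (Face.side (0, 0) .W) (0, 0) 3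
    (by decide)
  rw [hrel _ _ _ (by decide) (by decide) (by decide), zero_mul, hT] at hrow
  simp only [rowSumN, List.map_cons, List.map_nil, List.sum_cons, List.sum_nil, CWeights.mono, pow_zero,
    pow_one, mul_one, one_mul] at hrow
  linear_combination -hrow

/-- Instance `BSEN`: faces `[(0, 0), (0, -1), (1, -1), (1, 0)]`, root = the `N` side of `(0,0)`, relation at `(0,0)`;
7 walks end on a side of `(0,0)` (row cleared by `t^2`). [folklore] -/
private theorem inst_BSEN (hrel : ExactPlaquetteVertexRelationRC W t c) (ht : t ≠ 0) :
    c 1 * t ^ 2 + c 2 * W.u₁ * t + c 3 * W.v * t ^ 2 + c 0 * W.u₁ * W.u₂ ^ 2 * W.v * t ^ 5 + c 0 * W.u₂ * t ^ 3 + c 3 * W.u₁ * W.u₂ ^ 3 + c 2 * W.u₁ * W.u₂ ^ 2 * W.w₂ * t = 0 := by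
  have hT : termsN [(0, 0), (0, -1), (1, -1), (1, 0)] (Face.side (0, 0) .N) (0, 0) (depth [(0, 0), (0, -1), (1, -1), (1, 0)]) 2 =
      [⟨1, 0, 0, 0, 0, 0, 2⟩, ⟨2, 1, 0, 0, 0, 0, 1⟩, ⟨3, 0, 0, 1, 0, 0, 2⟩, ⟨0, 1, 2, 1, 0, 0, 5⟩, ⟨0, 0, 1, 0, 0, 0, 3⟩, ⟨3, 1, 3, 0, 0, 0, 0⟩, ⟨2, 1, 2, 0, 0, 1, 1⟩] := by
    decide
  have hrow := vertexFunctional_mul_pow_eq_rowSumN W ht c [(0, 0), (0, -1), (1, -1), (1, 0)] (Face.side (0, 0) .N) (0, 0) 2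
    (by decide)
  rw [hrel _ _ _ (by decide) (by decide) (by decide), zero_mul, hT] at hrow
  simp only [rowSumN, List.map_cons, List.map_nil, List.sum_cons, List.sum_nil, CWeights.mono, pow_zero,
    pow_one, mul_one, one_mul] at hrow
  linear_combination -hrow

/-- Instance `HSN`: faces `[(0, 0), (1, 0), (1, -1), (0, -1), (-1, -1), (-1, 0)]`, root = the `N` side of `(0,0)`, relation at `(0,0)`;
14 walks end on a side of `(0,0)` (row cleared by `t^4`). [folklore] -/
private theorem inst_HSN (hrel : ExactPlaquetteVertexRelationRC W t c) (ht : t ≠ 0) :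
    c 1 * t ^ 4 + c 0 * W.u₂ * t ^ 5 + c 3 * W.u₁ * W.u₂ ^ 3 * t ^ 2 + c 2 * W.u₁ * W.u₂ ^ 2 * W.w₂ * t ^ 3 + c 2 * W.u₁ ^ 2 * W.u₂ ^ 3 * W.v * t + c 3 * W.u₁ ^ 2 * W.u₂ ^ 2 * W.v * W.w₂ + c 3 * W.v * t ^ 4 + c 0 * W.u₁ * W.u₂ ^ 2 * W.v * t ^ 7 + c 2 * W.u₁ ^ 2 * W.u₂ * W.v * t + c 2 * W.u₁ * t ^ 3 + c 0 * W.u₁ ^ 3 * W.u₂ ^ 2 * W.v * t ^ 7 + c 3 * W.u₁ ^ 2 * W.u₂ ^ 2 * W.v * W.w₁ * t ^ 8 + c 3 * W.u₁ ^ 3 * W.u₂ * t ^ 6 + c 0 * W.u₁ ^ 2 * W.u₂ * W.w₁ * t ^ 5 = 0 := by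
  have hT : termsN [(0, 0), (1, 0), (1, -1), (0, -1), (-1, -1), (-1, 0)] (Face.side (0, 0) .N) (0, 0) (depth [(0, 0), (1, 0), (1, -1), (0, -1), (-1, -1), (-1, 0)]) 4 =
      [⟨1, 0, 0, 0, 0, 0, 4⟩, ⟨0, 0, 1, 0, 0, 0, 5⟩, ⟨3, 1, 3, 0, 0, 0, 2⟩, ⟨2, 1, 2, 0, 0, 1, 3⟩, ⟨2, 2, 3, 1, 0, 0, 1⟩, ⟨3, 2, 2, 1, 0, 1, 0⟩, ⟨3, 0, 0, 1, 0, 0, 4⟩, ⟨0, 1, 2, 1, 0, 0, 7⟩, ⟨2, 2, 1, 1, 0, 0, 1⟩, ⟨2, 1, 0, 0, 0, 0, 3⟩, ⟨0, 3, 2, 1, 0, 0, 7⟩, ⟨3, 2, 2, 1, 1, 0, 8⟩, ⟨3, 3, 1, 0, 0, 0, 6⟩, ⟨0, 2, 1, 0, 1, 0, 5⟩] := by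
    decide
  have hrow := vertexFunctional_mul_pow_eq_rowSumN W ht c [(0, 0), (1, 0), (1, -1), (0, -1), (-1, -1), (-1, 0)] (Face.side (0, 0) .N) (0, 0) 4
    (by decide)
  rw [hrel _ _ _ (by decide) (by decide) (by decide), zero_mul, hT] at hrow
  simp only [rowSumN, List.map_cons, List.map_nil, List.sum_cons, List.sum_nil, CWeights.mono, pow_zero,
    pow_one, mul_one, one_mul] at hrow
  linear_combination -hrow

/-- Instance `HNS`: faces `[(0, 0), (1, 0), (1, 1), (0, 1), (-1, 1), (-1, 0)]`, root = the `S` side of `(0,0)`, relation at `(0,0)`;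
14 walks end on a side of `(0,0)` (row cleared by `t^4`). [folklore] -/
private theorem inst_HNS (hrel : ExactPlaquetteVertexRelationRC W t c) (ht : t ≠ 0) :
    c 3 * t ^ 4 + c 0 * W.u₁ * t ^ 3 + c 1 * W.u₁ ^ 3 * W.u₂ * t ^ 6 + c 2 * W.u₁ ^ 2 * W.u₂ * W.w₁ * t ^ 5 + c 2 * W.u₁ ^ 3 * W.u₂ ^ 2 * W.v * t ^ 7 + c 1 * W.u₁ ^ 2 * W.u₂ ^ 2 * W.v * W.w₁ * t ^ 8 + c 1 * W.v * t ^ 4 + c 0 * W.u₁ ^ 2 * W.u₂ * W.v * t + c 2 * W.u₁ * W.u₂ ^ 2 * W.v * t ^ 7 + c 2 * W.u₂ * t ^ 5 + c 0 * W.u₁ ^ 2 * W.u₂ ^ 3 * W.v * t + c 1 * W.u₁ ^ 2 * W.u₂ ^ 2 * W.v * W.w₂ + c 1 * W.u₁ * W.u₂ ^ 3 * t ^ 2 + c 0 * W.u₁ * W.u₂ ^ 2 * W.w₂ * t ^ 3 = 0 := by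
  have hT : termsN [(0, 0), (1, 0), (1, 1), (0, 1), (-1, 1), (-1, 0)] (Face.side (0, 0) .S) (0, 0) (depth [(0, 0), (1, 0), (1, 1), (0, 1), (-1, 1), (-1, 0)]) 4 =
      [⟨3, 0, 0, 0, 0, 0, 4⟩, ⟨0, 1, 0, 0, 0, 0, 3⟩, ⟨1, 3, 1, 0, 0, 0, 6⟩, ⟨2, 2, 1, 0, 1, 0, 5⟩, ⟨2, 3, 2, 1, 0, 0, 7⟩, ⟨1, 2, 2, 1, 1, 0, 8⟩, ⟨1, 0, 0, 1, 0, 0, 4⟩, ⟨0, 2, 1, 1, 0, 0, 1⟩, ⟨2, 1, 2, 1, 0, 0, 7⟩, ⟨2, 0, 1, 0, 0, 0, 5⟩, ⟨0, 2, 3, 1, 0, 0, 1⟩, ⟨1, 2, 2, 1, 0, 1, 0⟩, ⟨1, 1, 3, 0, 0, 0, 2⟩, ⟨0, 1, 2, 0, 0, 1, 3⟩] := by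
    decide
  have hrow := vertexFunctional_mul_pow_eq_rowSumN W ht c [(0, 0), (1, 0), (1, 1), (0, 1), (-1, 1), (-1, 0)] (Face.side (0, 0) .S) (0, 0) 4
    (by decide)
  rw [hrel _ _ _ (by decide) (by decide) (by decide), zero_mul, hT] at hrow
  simp only [rowSumN, List.map_cons, List.map_nil, List.sum_cons, List.sum_nil, CWeights.mono, pow_zero,
    pow_one, mul_one, one_mul] at hrow
  linear_combination -hrow

/-- The six local group forms (adjacent excursions `[E;NW]`, `[W;ES]`, `[E;WS]`, `[W;EN]` and opposite
excursions `[N;EW]`, `[S;EW]`) annihilate `c`, for `u₁ u₂ v ≠ 0`. [folklore] -/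
private theorem forms (hrel : ExactPlaquetteVertexRelationRC W t c) (ht : t ≠ 0) (h1 : W.u₁ ≠ 0)
    (h2 : W.u₂ ≠ 0) (hv : W.v ≠ 0) :
    (W.v * c 1 + W.u₂ * t ^ 5 * c 2 + W.w₂ * t ^ 4 * c 3 = 0) ∧
    (W.u₂ * t ^ 5 * c 0 + W.w₂ * t ^ 4 * c 1 + W.v * c 3 = 0) ∧
    (W.w₁ * t * c 1 + W.u₁ * c 2 + W.v * t ^ 5 * c 3 = 0) ∧
    (W.u₁ * c 0 + W.v * t ^ 5 * c 1 + W.w₁ * t * c 3 = 0) ∧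
    (W.u₁ * t ^ 7 * c 0 + W.u₂ * t * c 2 + (W.w₂ + W.w₁ * t ^ 8) * c 3 = 0) ∧
    (W.u₂ * t * c 0 + (W.w₂ + W.w₁ * t ^ 8) * c 1 + W.u₁ * t ^ 7 * c 2 = 0) := by
  have hIE := inst_IE hrel ht
  have hIN := inst_IN hrel ht
  have hIW := inst_IW hrel ht
  have hIS := inst_IS hrel ht
  have hBNWE := inst_BNWE hrel ht
  have hBSEW := inst_BSEW hrel ht
  have hBSWE := inst_BSWE hrel ht
  have hBNEW := inst_BNEW hrel ht
  have hBSEN := inst_BSEN hrel ht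
  have hBSWN := inst_BSWN hrel ht
  have hBNES := inst_BNES hrel ht
  have hBNWS := inst_BNWS hrel ht
  have hHSN := inst_HSN hrel ht
  have hHNS := inst_HNS hrel ht
  have m12 : W.u₁ * W.u₂ ^ 2 ≠ 0 := mul_ne_zero h1 (pow_ne_zero _ h2)
  have m21 : W.u₁ ^ 2 * W.u₂ ≠ 0 := mul_ne_zero (pow_ne_zero _ h1) h2
  have m221 : W.u₁ ^ 2 * W.u₂ ^ 2 * W.v ≠ 0 := mul_ne_zero (mul_ne_zero (pow_ne_zero _ h1) (pow_ne_zero _ h2)) hv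
  refine ⟨?_, ?_, ?_, ?_, ?_, ?_⟩
  · have h : W.u₁ * W.u₂ ^ 2 * (W.v * c 1 + W.u₂ * t ^ 5 * c 2 + W.w₂ * t ^ 4 * c 3) = 0 := by
      linear_combination hBNWE - t ^ 2 * hIE
    exact (mul_eq_zero.1 h).resolve_left m12
  · have h : W.u₁ * W.u₂ ^ 2 * (W.u₂ * t ^ 5 * c 0 + W.w₂ * t ^ 4 * c 1 + W.v * c 3) = 0 := by
      linear_combination hBSEW - t ^ 2 * hIW
    exact (mul_eq_zero.1 h).resolve_left m12
  · have h : W.u₁ ^ 2 * W.u₂ * (W.w₁ * t * c 1 + W.u₁ * c 2 + W.v * t ^ 5 * c 3) = 0 := by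
      linear_combination hBSWE - t * hIE
    exact (mul_eq_zero.1 h).resolve_left m21
  · have h : W.u₁ ^ 2 * W.u₂ * (W.u₁ * c 0 + W.v * t ^ 5 * c 1 + W.w₁ * t * c 3) = 0 := by
      linear_combination hBNEW - t * hIW
    exact (mul_eq_zero.1 h).resolve_left m21
  · have h : W.u₁ ^ 2 * W.u₂ ^ 2 * W.v *
        (W.u₁ * t ^ 7 * c 0 + W.u₂ * t * c 2 + (W.w₂ + W.w₁ * t ^ 8) * c 3) = 0 := by
      linear_combination hHSN - t ^ 2 * hBSEN - t * hBSWN + t ^ 3 * hIN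
    exact (mul_eq_zero.1 h).resolve_left m221
  · have h : W.u₁ ^ 2 * W.u₂ ^ 2 * W.v *
        (W.u₂ * t * c 0 + (W.w₂ + W.w₁ * t ^ 8) * c 1 + W.u₁ * t ^ 7 * c 2) = 0 := by
      linear_combination hHNS - t * hBNES - t ^ 2 * hBNWS + t ^ 3 * hIS
    exact (mul_eq_zero.1 h).resolve_left m221

/-- The four remaining adjacent-excursion forms `[N;ES]`, `[S;NW]`, `[N;WS]`, `[S;EN]` (box instances
minus the group-one rows, divided by `u₁u₂²` resp. `u₁²u₂`). [folklore] -/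
private theorem forms_adj (hrel : ExactPlaquetteVertexRelationRC W t c) (ht : t ≠ 0) (h1 : W.u₁ ≠ 0)
    (h2 : W.u₂ ≠ 0) :
    (W.v * t ^ 5 * c 0 + W.w₂ * t * c 2 + W.u₂ * c 3 = 0) ∧
    (W.w₂ * t * c 0 + W.u₂ * c 1 + W.v * t ^ 5 * c 2 = 0) ∧
    (W.w₁ * t ^ 4 * c 0 + W.v * c 2 + W.u₁ * t ^ 5 * c 3 = 0) ∧
    (W.v * c 0 + W.u₁ * t ^ 5 * c 1 + W.w₁ * t ^ 4 * c 2 = 0) := by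
  have hIN := inst_IN hrel ht
  have hIS := inst_IS hrel ht
  have hBSEN := inst_BSEN hrel ht
  have hBNWS := inst_BNWS hrel ht
  have hBSWN := inst_BSWN hrel ht
  have hBNES := inst_BNES hrel ht
  have m12 : W.u₁ * W.u₂ ^ 2 ≠ 0 := mul_ne_zero h1 (pow_ne_zero _ h2)
  have m21 : W.u₁ ^ 2 * W.u₂ ≠ 0 := mul_ne_zero (pow_ne_zero _ h1) h2
  refine ⟨?_, ?_, ?_, ?_⟩
  · have h : W.u₁ * W.u₂ ^ 2 * (W.v * t ^ 5 * c 0 + W.w₂ * t * c 2 + W.u₂ * c 3) = 0 := by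
      linear_combination hBSEN - t * hIN
    exact (mul_eq_zero.1 h).resolve_left m12
  · have h : W.u₁ * W.u₂ ^ 2 * (W.w₂ * t * c 0 + W.u₂ * c 1 + W.v * t ^ 5 * c 2) = 0 := by
      linear_combination hBNWS - t * hIS
    exact (mul_eq_zero.1 h).resolve_left m12
  · have h : W.u₁ ^ 2 * W.u₂ * (W.w₁ * t ^ 4 * c 0 + W.v * c 2 + W.u₁ * t ^ 5 * c 3) = 0 := by
      linear_combination hBSWN - t ^ 2 * hIN
    exact (mul_eq_zero.1 h).resolve_left m21
  · have h : W.u₁ ^ 2 * W.u₂ * (W.v * c 0 + W.u₁ * t ^ 5 * c 1 + W.w₁ * t ^ 4 * c 2) = 0 := by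
      linear_combination hBNES - t ^ 2 * hIS
    exact (mul_eq_zero.1 h).resolve_left m21

/-- **Spin rigidity from the row-convex class**: `u₁ u₂ v ≠ 0`, `t ≠ 0`, `c ≠ 0` and the relation on
all row-convex domains force `t¹⁶ = −1`. [cite: Glazman2015WeightedSAW, Lemma 3.1 (proof: "either v = 0 or σ = ℓ/8")] -/
theorem t_pow_sixteen_of_exactPlaquetteVertexRelationRC (hrel : ExactPlaquetteVertexRelationRC W t c)
    (ht : t ≠ 0) (h1 : W.u₁ ≠ 0) (h2 : W.u₂ ≠ 0) (hv : W.v ≠ 0) (hc : c ≠ 0) : t ^ 16 = -1 := by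
  obtain ⟨fA1, fA1', fB1, fB1', fD2, fD2'⟩ := forms hrel ht h1 h2 hv
  exact t_pow_sixteen_of_forms ht h2 hv hc fA1 fA1' fB1 fB1' fD2 fD2'

/-- **Weight rigidity from the row-convex class** (same conclusion as the tree's `weight_rigidity`).
[cite: Glazman2015WeightedSAW, Lemma 3.1 (uniqueness of the weights at σ = ℓ/8)] -/
theorem weight_rigidityRC (hrel : ExactPlaquetteVertexRelationRC W t c) (ht : t ≠ 0) (h1 : W.u₁ ≠ 0)
    (h2 : W.u₂ ≠ 0) (hv : W.v ≠ 0) (hc : c ≠ 0) :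
    ∃ ε : ℂ, (ε = 1 ∨ ε = -1) ∧
      (c 0 + ε * c 2) ≠ 0 ∧ (c 1 + ε * c 3) ≠ 0 ∧
      t ^ 6 * ((c 0 + ε * c 2) ^ 4 + (c 1 + ε * c 3) ^ 4)
          - (1 + t ^ 12) * (c 0 + ε * c 2) ^ 2 * (c 1 + ε * c 3) ^ 2 ≠ 0 ∧
      W.v * (t ^ 6 * ((c 0 + ε * c 2) ^ 4 + (c 1 + ε * c 3) ^ 4)
          - (1 + t ^ 12) * (c 0 + ε * c 2) ^ 2 * (c 1 + ε * c 3) ^ 2) =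
        -ε * (t ^ 6 * ((c 0 + ε * c 2) ^ 4 + (c 1 + ε * c 3) ^ 4)
          - (t ^ 4 + t ^ 8) * (c 0 + ε * c 2) ^ 2 * (c 1 + ε * c 3) ^ 2) ∧
      ε * W.u₁ * (c 0 + ε * c 2) * (c 1 + ε * c 3) * (t ^ 4 - 1) =
        t * (1 + ε * W.v) * ((c 1 + ε * c 3) ^ 2 - t ^ 2 * (c 0 + ε * c 2) ^ 2) ∧
      W.u₂ * t ^ 2 * (c 0 + ε * c 2) =
        -ε * W.u₁ * (c 0 + ε * c 2) - t * (1 + ε * W.v) * (c 1 + ε * c 3) ∧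
      W.w₁ * t ^ 4 * (c 0 + ε * c 2) =
        -ε * W.v * (c 0 + ε * c 2) - ε * W.u₁ * t ^ 5 * (c 1 + ε * c 3) ∧
      W.w₂ * t * (c 0 + ε * c 2) = -ε * W.v * t ^ 5 * (c 0 + ε * c 2) - W.u₂ * (c 1 + ε * c 3) := by
  have h16 := t_pow_sixteen_of_exactPlaquetteVertexRelationRC hrel ht h1 h2 hv hc
  obtain ⟨fA1, fA1', fB1, fB1', -, -⟩ := forms hrel ht h1 h2 hv
  obtain ⟨fC1, fC1', fE1, fE1'⟩ := forms_adj hrel ht h1 h2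
  obtain ⟨ε, hε, hab⟩ := exists_eps_component_ne_zero hc
  exact ⟨ε, hε, rigidity_of_forms ht h2 h16 (inst_IE hrel ht) (inst_IN hrel ht) (inst_IW hrel ht)
    (inst_IS hrel ht) fA1 fA1' fB1 fB1' fC1 fC1' fE1 fE1' hε hab⟩

/-- **The weights lie on the Yang–Baxter curve** (row-convex class): `W = ybCurve ε t r`, `r` the
coefficient ratio of a nonzero `ρ²`-eigencomponent. [cite: Glazman2015WeightedSAW, Lemma 3.1 (uniqueness of the weights at σ = ℓ/8)] -/
theorem weights_eq_ybCurveRC (hrel : ExactPlaquetteVertexRelationRC W t c) (ht : t ≠ 0) (h1 : W.u₁ ≠ 0)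
    (h2 : W.u₂ ≠ 0) (hv : W.v ≠ 0) (hc : c ≠ 0) :
    ∃ ε : ℂ, (ε = 1 ∨ ε = -1) ∧ c 0 + ε * c 2 ≠ 0 ∧
      W = ybCurve ε t ((c 1 + ε * c 3) / (c 0 + ε * c 2)) := by
  have h16 := t_pow_sixteen_of_exactPlaquetteVertexRelationRC hrel ht h1 h2 hv hc
  obtain ⟨ε, hε, ha, hb, hD, hR5, hR4, hR3, hR2, hR1⟩ := weight_rigidityRC hrel ht h1 h2 hv hc
  have hεne : ε ≠ 0 := by rcases hε with rfl | rfl <;> norm_num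
  exact ⟨ε, hε, ha, eq_ybCurve_of_system ht (t_pow_four_ne_one h16) hεne ha hb hD hR5 hR4 hR3 hR2 hR1⟩

end RigidityRC

section PrintedRC

variable {W : CWeights} {c : Fin 4 → ℂ}

/-- **Printed identification from the row-convex class**: at `σ = 5/8` an odd relation
(`c_E + c_W = 0`) with `u₁u₂v ≠ 0` and ratio `r(θ)`, `weightDen θ ≠ 0`, has exactly the printed
weights `W(θ)`. [cite: GlazmanManolescu2019, eq. (1), Lemma 2.1] -/
theorem weights_eq_printedWeightsRC (hrel : ExactPlaquetteVertexRelationRC W tFiveEighths c)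
    (h1 : W.u₁ ≠ 0) (h2 : W.u₂ ≠ 0) (hv : W.v ≠ 0) (hc : c ≠ 0)
    (hodd₀ : c 0 + c 2 = 0) (θ : ℝ) (hθ : weightDen θ ≠ 0)
    (hratio : c 1 - c 3 = ybRatio θ * (c 0 - c 2)) : W = printedWeights θ := by
  obtain ⟨ε, hε, ha, hW⟩ := weights_eq_ybCurveRC hrel tFiveEighths_ne_zero h1 h2 hv hc
  rcases hε with rfl | rfl
  · exact absurd (by linear_combination hodd₀) ha
  · have hr : (c 1 + (-1) * c 3) / (c 0 + (-1) * c 2) = ybRatio θ := by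
      rw [div_eq_iff ha]; linear_combination hratio
    rw [hW, hr, printedWeights_eq_ybCurve θ hθ]

/-- The same for `θ ∈ [π/3, 2π/3]` (the denominator does not vanish there). [cite: GlazmanManolescu2019, eq. (1), Lemma 2.1] -/
theorem weights_eq_printedWeightsRC_of_mem (hrel : ExactPlaquetteVertexRelationRC W tFiveEighths c)
    (h1 : W.u₁ ≠ 0) (h2 : W.u₂ ≠ 0) (hv : W.v ≠ 0) (hc : c ≠ 0)
    (hodd₀ : c 0 + c 2 = 0) {θ : ℝ} (hθ : θ ∈ Set.Icc (π / 3) (2 * π / 3))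
    (hratio : c 1 - c 3 = ybRatio θ * (c 0 - c 2)) : W = printedWeights θ :=
  weights_eq_printedWeightsRC hrel h1 h2 hv hc hodd₀ θ (weightDen_ne_zero_of_mem hθ) hratio

end PrintedRC

/-- **The two-sided classification of exact plaquette vertex relations on `ℤ²` at `σ = 5/8`, with ONE
technique class** (row-convex domains, boundary roots): (→) the printed Yang–Baxter weights `W(θ)` carry
the relation with coefficients `(1, r(θ), −1, −r(θ))` for every `θ ∈ [π/3, 2π/3]`; (←) conversely a
weight system with `u₁u₂v ≠ 0` carrying a relation of that odd shape with ratio `r(θ)` IS `W(θ)`.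
[cite: GlazmanManolescu2019, eq. (1), Lemma 2.1] [cite: Glazman2015WeightedSAW, Lemma 3.1] -/
def _root_.Literature.Barriers.CriticalPhenomena.PlaquetteWalkYBClassification : Prop :=
  (∀ θ : ℝ, θ ∈ Set.Icc (π / 3) (2 * π / 3) →
      ExactPlaquetteVertexRelationRC (printedWeights θ) tFiveEighths (ybCoeff θ)) ∧
  (∀ (W : CWeights) (c : Fin 4 → ℂ) (θ : ℝ), θ ∈ Set.Icc (π / 3) (2 * π / 3) →
      W.u₁ ≠ 0 → W.u₂ ≠ 0 → W.v ≠ 0 → c ≠ 0 → c 0 + c 2 = 0 →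
      c 1 - c 3 = ybRatio θ * (c 0 - c 2) → ExactPlaquetteVertexRelationRC W tFiveEighths c →
        W = printedWeights θ)

/-- **The classification holds.** [cite: GlazmanManolescu2019, eq. (1), Lemma 2.1] [cite: Glazman2015WeightedSAW, Lemma 3.1] -/
theorem _root_.Literature.Barriers.CriticalPhenomena.PlaquetteWalkYBClassification_holds :
    PlaquetteWalkYBClassification :=
  ⟨fun _ hθ => exactPlaquetteVertexRelationRC_printed hθ,
    fun _ _ _ hθ h1 h2 hv hc h0 hr hrel => weights_eq_printedWeightsRC_of_mem hrel h1 h2 hv hc h0 hθ hr⟩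

/-- **Spin rigidity, row-convex class, in the spin variable**: the tree's named barrier
`PlaquetteWalkSpinRigidity` follows from the row-convex version. [cite: Glazman2015WeightedSAW, Lemma 3.1] -/
example : PlaquetteWalkSpinRigidity :=
  fun _ _ _ ht h1 h2 hv hc hrel => t_pow_sixteen_of_exactPlaquetteVertexRelationRC hrel.toRC ht h1 h2 hv hc

end Literature.Barriers.CriticalPhenomena.PlaquetteWalk
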